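import Literature.Probability.MarkovChains.PeskunOrdering
import HarnessLib

/-!
# Finite state space: under a kernel symmetric for an involution of the state space, Kemeny–Snell's asymptotic variance SPLITS over parity — `v(f, π, P) = v(f₊, π, P) + v(f₋, π, P)`

HONEST FRAMING: exact (Metropolis-corrected) sampling algorithms for lattice gauge theory;
figures of merit are autocorrelation/cost numbers at stated couplings and volumes; no
continuum-physics claim.  (SCALAR calibration rung S0-A: not a gauge result.)

Venture `LatticeQCDFlow` (cell pub-lqcd), topic `Exactness`; FANOUT row 2 (`s0-phi4`).  NEW WORK of the
cell, the finite-state companion (NO summability hypotheses) of `FlowSamplerSymmetrisationParityDecomposition`,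
in the vocabulary of `Literature.Probability.MarkovChains.PeskunOrdering` (`asympVar` = Kemeny–Snell's closed
form of Peskun 1973 eq. (4), `fundamentalMatrix`, `limitMatrix`, `piInner`, `centred`).  Data: a permutation
`σ` of the finite state space with `π ∘ σ = π` and a `σ`-EQUIVARIANT kernel `P (σ x) (σ y) = P x y` (e.g. a
Metropolis–Hastings kernel with a symmetrised proposal), row-stochastic, `π` stationary, `I − (P − Π)`
invertible; `f₊ = ½(f + f∘σ)`, `f₋ = ½(f − f∘σ)` for an involutive `σ`.

* `mulVec_comp_symm`, `limitMatrix_mulVec_comp_symm`, `fundamentalMatrix_mulVec_comp_symm` — `P`, `Π`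
  and the fundamental matrix `Z` commute with `f ↦ f ∘ σ`;
* `piInner_eq_zero_of_parity` — even ⟂ odd in `ℓ²(π)`;
* **`asympVar_parity_split`** — for involutive `σ`: `v(f, π, P) = v(f₊, π, P) + v(f₋, π, P)` for EVERY `f`;
* `mhRate_equivariant`, `mhKernel_equivariant` — a Metropolis–Hastings kernel with a `σ`-symmetric
  proposal and `σ`-invariant `π` is `σ`-equivariant; **`mh_asympVar_parity_split`** — hence the split for
  every irreducible such sampler (e.g. a symmetrised flow proposal on a finite state space).

With `ReversibleKernelMixtureHarmonicMean` / `…Tight` this is the finite-state picture behind the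
mixed-parity witness (`FlowSamplerSymmetrisationMixedParityPeskun`).  Nothing is cited as a fact.

NOT CLAIMED: any comparison between a kernel and its symmetrisation (Peskun's order is silent there);
general state spaces (that is `FlowSamplerSymmetrisationParityDecomposition`); any value for any run.
-/

namespace Summit.Ventures.LatticeQCDFlow.Exactness

open Finset Matrix Literature.Probability.MarkovChains

variable {X : Type*} [Fintype X] [DecidableEq X]

/-! ## §1 Equivariance of `P`, `Π`, `I − (P − Π)` and `Z` -/

omit [DecidableEq X] in
/-- `P (f ∘ σ) = (P f) ∘ σ` for a `σ`-equivariant kernel. -/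
theorem mulVec_comp_symm {P : Matrix X X ℝ} {σ : Equiv.Perm X} (hP : ∀ x y, P (σ x) (σ y) = P x y)
    (f : X → ℝ) (x : X) : (P *ᵥ fun y => f (σ y)) x = (P *ᵥ f) (σ x) := by
  simp only [Matrix.mulVec, dotProduct]
  rw [← Equiv.sum_comp σ (fun y => P (σ x) y * f y)]
  simp only [hP]

omit [DecidableEq X] in
/-- `Π (f ∘ σ) = (Π f) ∘ σ` (`Π` the rank-one limit matrix, `π ∘ σ = π`). -/
theorem limitMatrix_mulVec_comp_symm {π : X → ℝ} {σ : Equiv.Perm X} (hπ : ∀ x, π (σ x) = π x)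
    (f : X → ℝ) (x : X) :
    (limitMatrix π *ᵥ fun y => f (σ y)) x = (limitMatrix π *ᵥ f) (σ x) := by
  simp only [limitMatrix, Matrix.mulVec, dotProduct, Matrix.of_apply]
  rw [← Equiv.sum_comp σ (fun y => π y * f y)]
  simp only [hπ]

/-- `(I − (P − Π)) (f ∘ σ) = ((I − (P − Π)) f) ∘ σ`. -/
theorem fundamentalInv_mulVec_comp_symm {π : X → ℝ} {P : Matrix X X ℝ} {σ : Equiv.Perm X}
    (hπ : ∀ x, π (σ x) = π x) (hP : ∀ x y, P (σ x) (σ y) = P x y) (f : X → ℝ) (x : X) :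
    ((1 - (P - limitMatrix π)) *ᵥ fun y => f (σ y)) x = ((1 - (P - limitMatrix π)) *ᵥ f) (σ x) := by
  simp only [Matrix.sub_mulVec, Matrix.one_mulVec, Pi.sub_apply, mulVec_comp_symm hP,
    limitMatrix_mulVec_comp_symm hπ]

/-- **`Z (f ∘ σ) = (Z f) ∘ σ`** for the fundamental matrix (invertibility of `I − (P − Π)`). -/
theorem fundamentalMatrix_mulVec_comp_symm {π : X → ℝ} {P : Matrix X X ℝ} {σ : Equiv.Perm X}
    (hπ : ∀ x, π (σ x) = π x) (hP : ∀ x y, P (σ x) (σ y) = P x y)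
    (hK : IsUnit (1 - (P - limitMatrix π))) (f : X → ℝ) :
    (fundamentalMatrix π P *ᵥ fun y => f (σ y)) = fun x => (fundamentalMatrix π P *ᵥ f) (σ x) := by
  apply Matrix.mulVec_injective_iff_isUnit.2 hK
  funext x
  show ((1 - (P - limitMatrix π)) *ᵥ (fundamentalMatrix π P *ᵥ fun y => f (σ y))) x
    = ((1 - (P - limitMatrix π)) *ᵥ fun x => (fundamentalMatrix π P *ᵥ f) (σ x)) x
  rw [Matrix.mulVec_mulVec, fundamentalInv_mul_fundamentalMatrix hK, Matrix.one_mulVec,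
    fundamentalInv_mulVec_comp_symm hπ hP (fundamentalMatrix π P *ᵥ f) x, Matrix.mulVec_mulVec,
    fundamentalInv_mul_fundamentalMatrix hK, Matrix.one_mulVec]

/-! ## §2 Parity -/

omit [DecidableEq X] in
/-- **Even ⟂ odd in `ℓ²(π)`**: `u ∘ σ = u`, `v ∘ σ = −v`, `π ∘ σ = π` ⇒ `⟨u, v⟩_π = 0`. -/
theorem piInner_eq_zero_of_parity {π u v : X → ℝ} {σ : Equiv.Perm X} (hπ : ∀ x, π (σ x) = π x)
    (hu : ∀ x, u (σ x) = u x) (hv : ∀ x, v (σ x) = -v x) : piInner π u v = 0 := by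
  unfold piInner
  have h : ∑ x, π x * (u x * v x) = ∑ x, π (σ x) * (u (σ x) * v (σ x)) :=
    (Equiv.sum_comp σ (fun x => π x * (u x * v x))).symm
  have e : ∑ x, π (σ x) * (u (σ x) * v (σ x)) = -∑ x, π x * (u x * v x) := by
    rw [← Finset.sum_neg_distrib]
    exact Finset.sum_congr rfl fun x _ => by rw [hπ, hu, hv]; ring
  linarith [h.trans e]

/-- `Z` maps a function of parity `c` (`v ∘ σ = c·v`) to a function of parity `c`. -/
theorem fundamentalMatrix_mulVec_parity {π : X → ℝ} {P : Matrix X X ℝ} {σ : Equiv.Perm X}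
    (hπ : ∀ x, π (σ x) = π x) (hP : ∀ x y, P (σ x) (σ y) = P x y)
    (hK : IsUnit (1 - (P - limitMatrix π))) {v : X → ℝ} {c : ℝ} (hv : ∀ x, v (σ x) = c * v x)
    (x : X) : (fundamentalMatrix π P *ᵥ v) (σ x) = c * (fundamentalMatrix π P *ᵥ v) x := by
  have h := fundamentalMatrix_mulVec_comp_symm hπ hP hK v
  have e : (fun y => v (σ y)) = c • v := funext fun y => by rw [hv]; rfl
  rw [e, Matrix.mulVec_smul] at h
  have := congrFun h x
  simp only [Pi.smul_apply, smul_eq_mul] at this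
  exact this.symm

/-! ## §3 The split of the asymptotic variance -/

omit [DecidableEq X] in
/-- Bilinear expansion of `⟨u + v, w⟩_π`. -/
theorem piInner_add_left' (π u v w : X → ℝ) :
    piInner π (fun x => u x + v x) w = piInner π u w + piInner π v w := by
  unfold piInner
  rw [← Finset.sum_add_distrib]
  exact Finset.sum_congr rfl fun x _ => by ring

omit [DecidableEq X] in
/-- Bilinear expansion of `⟨w, u + v⟩_π`. -/
theorem piInner_add_right' (π u v w : X → ℝ) :
    piInner π w (fun x => u x + v x) = piInner π w u + piInner π w v := by
  unfold piInner
  rw [← Finset.sum_add_distrib]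
  exact Finset.sum_congr rfl fun x _ => by ring

/-- **`v(f, π, P) = v(f₊, π, P) + v(f₋, π, P)`** for every `f`: `σ` an involutive permutation with
`π ∘ σ = π` (`Σ π = 1`), `P` row-stochastic, `σ`-equivariant, `π` stationary, `I − (P − Π)` invertible. -/
theorem asympVar_parity_split {π : X → ℝ} (hπ1 : ∑ x, π x = 1) {P : Matrix X X ℝ}
    (hP : IsRowStochastic P) (hst : IsStationary π P) (hK : IsUnit (1 - (P - limitMatrix π)))
    {σ : Equiv.Perm X} (hσσ : ∀ x, σ (σ x) = x) (hπ : ∀ x, π (σ x) = π x)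
    (hPσ : ∀ x y, P (σ x) (σ y) = P x y) (f : X → ℝ) :
    asympVar f π P
      = asympVar (fun x => (f x + f (σ x)) / 2) π P + asympVar (fun x => (f x - f (σ x)) / 2) π P := by
  rw [asympVar_eq_centred hπ1 hP hst hK, asympVar_eq_centred hπ1 hP hst hK,
    asympVar_eq_centred hπ1 hP hst hK]
  -- parities of the centred parts
  set u := centred π (fun x => (f x + f (σ x)) / 2) with hu
  set v := centred π (fun x => (f x - f (σ x)) / 2) with hv
  have hmean_odd : ∑ y, π y * ((f y - f (σ y)) / 2) = 0 := by
    have h : ∑ y, π y * f (σ y) = ∑ y, π y * f y := by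
      rw [← Equiv.sum_comp σ (fun y => π y * f y)]
      simp only [hπ]
    have e : ∑ y, π y * ((f y - f (σ y)) / 2) = ((∑ y, π y * f y) - ∑ y, π y * f (σ y)) / 2 := by
      rw [← Finset.sum_sub_distrib, Finset.sum_div]
      exact Finset.sum_congr rfl fun y _ => by ring
    rw [e, h, sub_self, zero_div]
  have hu_even : ∀ x, u (σ x) = u x := fun x => by
    simp only [hu, centred, hσσ]; ring
  have hv_odd : ∀ x, v (σ x) = -v x := fun x => by
    simp only [hv, centred, hσσ, hmean_odd]; ring
  have hsum : centred π f = fun x => u x + v x := by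
    funext x
    simp only [hu, hv, centred]
    have e2 : ∑ y, π y * ((f y + f (σ y)) / 2) = ∑ y, π y * f y := by
      have h : ∑ y, π y * f (σ y) = ∑ y, π y * f y := by
        rw [← Equiv.sum_comp σ (fun y => π y * f y)]
        simp only [hπ]
      have e : ∑ y, π y * ((f y + f (σ y)) / 2) = ((∑ y, π y * f y) + ∑ y, π y * f (σ y)) / 2 := by
        rw [← Finset.sum_add_distrib, Finset.sum_div]
        exact Finset.sum_congr rfl fun y _ => by ring
      rw [e, h]; ring
    rw [e2, hmean_odd]
    ring
  rw [hsum]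
  -- `Z u` even, `Z v` odd; cross terms vanish
  have hZu : ∀ x, (fundamentalMatrix π P *ᵥ u) (σ x) = (fundamentalMatrix π P *ᵥ u) x := fun x => by
    have := fundamentalMatrix_mulVec_parity hπ hPσ hK (v := u) (c := 1) (fun x => by rw [hu_even, one_mul]) x
    rw [this, one_mul]
  have hZv : ∀ x, (fundamentalMatrix π P *ᵥ v) (σ x) = -(fundamentalMatrix π P *ᵥ v) x := fun x => by
    have := fundamentalMatrix_mulVec_parity hπ hPσ hK (v := v) (c := -1) (fun x => by rw [hv_odd]; ring) x
    rw [this]; ring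
  have c1 : piInner π u (fundamentalMatrix π P *ᵥ v) = 0 := piInner_eq_zero_of_parity hπ hu_even hZv
  have c2 : piInner π v (fundamentalMatrix π P *ᵥ u) = 0 := by
    rw [piInner_comm]; exact piInner_eq_zero_of_parity hπ hZu hv_odd
  have c3 : piInner π u v = 0 := piInner_eq_zero_of_parity hπ hu_even hv_odd
  have c4 : piInner π v u = 0 := by rw [piInner_comm]; exact c3
  have eZ : fundamentalMatrix π P *ᵥ (fun x => u x + v x)
      = fun x => (fundamentalMatrix π P *ᵥ u) x + (fundamentalMatrix π P *ᵥ v) x := by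
    have : (fun x => u x + v x) = u + v := rfl
    rw [this, Matrix.mulVec_add]; rfl
  rw [eZ, piInner_add_left', piInner_add_right', piInner_add_right', piInner_add_left',
    piInner_add_right', piInner_add_right', c1, c2, c3, c4]
  ring

/-! ## §4 Metropolis–Hastings kernels with a symmetric proposal are equivariant -/

omit [Fintype X] [DecidableEq X] in
/-- The Metropolis–Hastings RATE is `σ`-equivariant when the proposal and `π` are. -/
theorem mhRate_equivariant {T : X → X → ℝ} {π : X → ℝ} {σ : Equiv.Perm X}
    (hT : ∀ x y, T (σ x) (σ y) = T x y) (hπ : ∀ x, π (σ x) = π x) (x y : X) :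
    mhRate T π (σ x) (σ y) = mhRate T π x y := by
  unfold mhRate
  rw [hT, hT, hπ, hπ]

/-- **A Metropolis–Hastings kernel with a `σ`-symmetric proposal (`T (σx) (σy) = T x y`) and
`σ`-invariant `π` is `σ`-equivariant** — e.g. the kernel of a symmetrised flow proposal. -/
theorem mhKernel_equivariant {T : X → X → ℝ} {π : X → ℝ} {σ : Equiv.Perm X}
    (hT : ∀ x y, T (σ x) (σ y) = T x y) (hπ : ∀ x, π (σ x) = π x) (x y : X) :
    mhKernel T π (σ x) (σ y) = mhKernel T π x y := by
  by_cases h : y = x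
  · subst h
    rw [mhKernel_self, mhKernel_self]
    congr 1
    rw [Finset.sum_erase_eq_sub (Finset.mem_univ _), Finset.sum_erase_eq_sub (Finset.mem_univ _),
      mhRate_equivariant hT hπ]
    congr 1
    rw [← Equiv.sum_comp σ (fun z => mhRate T π (σ y) z)]
    exact Finset.sum_congr rfl fun z _ => mhRate_equivariant hT hπ y z
  · have h' : σ y ≠ σ x := fun e => h (σ.injective e)
    rw [mhKernel_of_ne h', mhKernel_of_ne h, mhRate_equivariant hT hπ]

/-- **COROLLARY: parity split of the asymptotic variance for every Metropolis–Hastings sampler with a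
symmetric proposal** (`π > 0`, `Σ π = 1`, `T ≥ 0` sub-stochastic, kernel irreducible, `σ` involutive,
`π ∘ σ = π`, `T (σx) (σy) = T x y`). -/
theorem mh_asympVar_parity_split {π : X → ℝ} (hπ0 : ∀ x, 0 < π x) (hπ1 : ∑ x, π x = 1)
    {T : X → X → ℝ} (hT0 : ∀ x y, 0 ≤ T x y) (hTrow : ∀ x, ∑ y, T x y ≤ 1)
    (hirr : Literature.Probability.MarkovChains.IsIrreducible (mhKernel T π : Matrix X X ℝ))
    {σ : Equiv.Perm X} (hσσ : ∀ x, σ (σ x) = x) (hπ : ∀ x, π (σ x) = π x)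
    (hT : ∀ x y, T (σ x) (σ y) = T x y) (f : X → ℝ) :
    asympVar f π (mhKernel T π)
      = asympVar (fun x => (f x + f (σ x)) / 2) π (mhKernel T π)
        + asympVar (fun x => (f x - f (σ x)) / 2) π (mhKernel T π) := by
  have hP : IsRowStochastic (mhKernel T π : Matrix X X ℝ) := mhKernel_isRowStochastic hT0 hTrow hπ0
  have hst : IsStationary π (mhKernel T π : Matrix X X ℝ) := mhKernel_isStationary hπ0 T
  exact asympVar_parity_split hπ1 hP hst (isUnit_fundamentalInv hπ1 hP hst hirr) hσσ hπ
    (fun x y => mhKernel_equivariant hT hπ x y) f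

end Summit.Ventures.LatticeQCDFlow.Exactness
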